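import Literature.AlgebraicGeometry.Frobenioids.ModelFrobenioidPhiBirat
import Literature.AlgebraicGeometry.Frobenioids.GeometricFrobenioidNonDilating
import Literature.AlgebraicGeometry.Frobenioids.GeometricDivisorScaling
import HarnessLib

/-!
# Frobenioids I, Theorem 6.2 (iii): under the support hypothesis, every object of `C_{K̃/K}` is strictly rational
# (Def. 4.5 (ii)) — PROOF

Mochizuki, *The geometry of Frobenioids I: the general theory*, Kyushu J. Math. **62** (2008) 293–400,
proof of Theorem 6.2 (iii), kurims text p. 112 l. 4–8: "Now suppose that for every finite extension `L ⊆ K̃` of `K`,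
and every `D ∈ D_L`, it holds that `D` lies in the support of the image in `Φ(L)^gp` of an element of `B(L)`. Then
it follows formally [cf. Definition 4.5, (ii)] that `C` is of [strictly] rational type [since `Φ` has already been
observed to be perf-factorial — cf. Example 6.1]." [cite: MochizukiFrdI2008, Thm. 6.2 (iii) p.112]

PROOF-ONLY (seat abc-iut-L6-t10 gen 2, S3 sub-DAG holder — the "rational type" part of row **T62iii/L08**), over
abc-iut-L1-t3's interface `GeometricDivisorData` v3, THE birationalization `PreFrobenioid.biratData` of the
constructed `geomFrobenioid Γ` (`Φ^birat = Div_B(B)`, `ModelFrobenioidPhiBirat.lean`; requires `Φ(L)` divisorial,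
hence the closure hypothesis `hsub`, plan/GAP-LEDGER G-L6t10g2-1) and ANY support predicate `Supp` obeying the
support axiom `hSupp` ("`𝔭 ∈ Supp(a)` iff some primary element of the class `𝔭` is `≼ a`"). PROVED:
* `GeometricDivisorData.single_precsim_of_mem_support` — a Cartier multiple `i · s ∈ Φ(L)` is `≼ D` for every
  `D ∈ Φ(L)` with `s ∈ supp D` (`(i+1)N · D − i · s ∈ Φ(L)` for `N = ∏_{supp D} k_t`);
* `GeometricDivisorData.of_div_of_eq_divPhi` — `[D]/[E] = Div_B(g)` in `Φ(L)^gp` when `div(g) = D − E`;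
* `isStrictlyRational_geom` — **every object of `C_{K̃/K}` is strictly rational** under the support hypothesis of
  Thm. 6.2 (iii) (zero/pole decomposition `div(g^N) = D − E`, `GeometricDivisorScaling.lean`), for THE
  birationalization and any `Supp` as above; `isRational_geom`.
No definitions; nothing here bears on [IUTchIII] or asserts anything about abc.
-/

noncomputable section

namespace Literature.AlgebraicGeometry.Frobenioids

open CategoryTheory Opposite Function

namespace GeometricDivisorData

variable {K : Type} [Field K] {Kt : Type} [Field Kt] [Algebra K Kt] (Γ : GeometricDivisorData K Kt)
  (X : FinSubextCat K Kt)

/-- A Cartier multiple `i · s ∈ Φ(L)` of a prime divisor `s` in the support of `D ∈ Φ(L)` satisfies `i · s ≼ D`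
INSIDE `Φ(L)`: with `N = ∏_{t ∈ supp D} k_t` and `j = N · D_s ≥ 1`,
`(i+1)N · D − i · s = (j−1) · (i · s) + j · s + (i+1)N · (D − D_s · s)` is a sum of elements of `Φ(L)`.
[cite: MochizukiFrdI2008, Ex. 6.1 p.109] -/
theorem single_precsim_of_mem_support {s : Γ.primeDiv X} {i : ℕ} (hi : Finsupp.single s i ∈ Γ.Phi X)
    (D : Γ.Phi X) (hs : s ∈ (D : Γ.primeDiv X →₀ ℕ).support) :
    Precsim (Multiplicative.ofAdd (⟨_, hi⟩ : Γ.Phi X)) (Multiplicative.ofAdd D) := by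
  classical
  choose k hk0 hk using Γ.qCartier X
  set T := (D : Γ.primeDiv X →₀ ℕ).support with hT
  set N := ∏ t ∈ T, k t with hN
  have hN0 : 0 < N := Finset.prod_pos fun t _ => hk0 t
  have hDs : 0 < (D : Γ.primeDiv X →₀ ℕ) s := Nat.pos_of_ne_zero (Finsupp.mem_support_iff.mp hs)
  set j := N * (D : Γ.primeDiv X →₀ ℕ) s with hj
  have hj1 : 1 ≤ j := Nat.mul_pos hN0 hDs
  -- `j · s ∈ Φ(L)` and `N · (D − D_s s) ∈ Φ(L)`
  have hjmem : Finsupp.single s j ∈ Γ.Phi X := by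
    rw [hj, hN, ← Finset.prod_erase_mul T k hs,
      show (∏ x ∈ T.erase s, k x) * k s * (D : Γ.primeDiv X →₀ ℕ) s =
        ((∏ x ∈ T.erase s, k x) * (D : Γ.primeDiv X →₀ ℕ) s) • k s by rw [smul_eq_mul]; ring,
      ← Finsupp.smul_single]
    exact AddSubmonoid.nsmul_mem _ (hk s) _
  have hrest : N • Finsupp.erase s (D : Γ.primeDiv X →₀ ℕ) ∈ Γ.Phi X :=
    Γ.prod_smul_mem X T k hk _ (by rw [Finsupp.support_erase]; exact Finset.erase_subset _ _)
  refine ⟨(i + 1) * N, Nat.mul_pos (Nat.succ_pos i) hN0, ?_⟩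
  rw [← ofAdd_nsmul, Γ.ofAdd_dvd_ofAdd_iff X]
  refine ⟨⟨(j - 1) • Finsupp.single s i + Finsupp.single s j + (i + 1) • (N • Finsupp.erase s (D : _ →₀ ℕ)),
    add_mem (add_mem (AddSubmonoid.nsmul_mem _ hi _) hjmem) (AddSubmonoid.nsmul_mem _ hrest _)⟩, ?_⟩
  change ((i + 1) * N) • (D : Γ.primeDiv X →₀ ℕ) = Finsupp.single s i +
    ((j - 1) • Finsupp.single s i + Finsupp.single s j + (i + 1) • (N • Finsupp.erase s (D : _ →₀ ℕ)))
  clear_value j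
  obtain ⟨j', rfl⟩ := Nat.exists_eq_add_one_of_ne_zero (by omega : j ≠ 0)
  ext Q
  by_cases hQ : Q = s
  · subst hQ
    simp only [Finsupp.coe_smul, Pi.smul_apply, smul_eq_mul, Finsupp.coe_add, Pi.add_apply,
      Finsupp.single_eq_same, Finsupp.erase_same, mul_zero, add_zero, Nat.add_sub_cancel]
    rw [mul_assoc, ← hj]
    ring
  · simp only [Finsupp.coe_smul, Pi.smul_apply, smul_eq_mul, Finsupp.coe_add, Pi.add_apply,
      Finsupp.single_eq_of_ne hQ, Finsupp.erase_ne hQ, mul_zero, add_zero, zero_add]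
    ring

/-- In `Φ(L)^gp`: `[D]/[E] = Div_B(g)` when `div(g) = D − E` as integral coefficient vectors (through the injection
`Φ(L)^gp ↪ ℤ[D_L]`). [cite: MochizukiFrdI2008, Ex. 6.1 p.109] -/
theorem of_div_of_eq_divPhi {D E : Γ.primeDiv X →₀ ℕ} (hD : D ∈ Γ.Phi X) (hE : E ∈ Γ.Phi X) (g : Γ.B X)
    (h : Multiplicative.toAdd (Γ.div X g) = DivisorCoeff.toInt D - DivisorCoeff.toInt E) :
    Algebra.GrothendieckGroup.of (Multiplicative.ofAdd (⟨D, hD⟩ : Γ.Phi X)) /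
        Algebra.GrothendieckGroup.of (Multiplicative.ofAdd (⟨E, hE⟩ : Γ.Phi X)) = Γ.divPhi X g := by
  apply Γ.phiGpHom_injective X
  rw [map_div, phiGpHom_of, phiGpHom_of, phiGpHom_divPhi, toAdd_ofAdd, toAdd_ofAdd, ← ofAdd_sub,
    ← ofAdd_toAdd (Γ.div X g), h]

end GeometricDivisorData

/-! ### Strict rationality of `C_{K̃/K}` under the support hypothesis -/

section Geom

variable {K : Type} [Field K] {Kt : Type} [Field Kt] [Algebra K Kt] (Γ : GeometricDivisorData K Kt)

/-- **Theorem 6.2 (iii), proof: "it follows formally [cf. Definition 4.5, (ii)] that `C` is of [strictly] rational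
type"** (FrdI p. 112 l. 4–8) — PROVED for THE constructed `C_{K̃/K}` at THE birationalization `PreFrobenioid.biratData`
and for ANY support predicate obeying the support axiom `hSupp`, under the support hypothesis of Thm. 6.2 (iii) and
the closure property `hsub` of the interface data (GAP-LEDGER G-L6t10g2-1): every object is strictly rational
(Def. 4.5 (ii)) — for the prime of `Φ(L)` at the prime divisor `s` take `g = f^{±N}` with `div(g) = D − E`,
`D, E ∈ Φ(L)`, `s ∈ supp D`, `s ∉ supp E` (`GeometricDivisorScaling.lean`). [cite: MochizukiFrdI2008, Thm. 6.2 (iii) p.112] -/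
theorem isStrictlyRational_geom
    (hsub : ∀ (X : FinSubextCat K Kt) (D E : Γ.primeDiv X →₀ ℕ), D ∈ Γ.Phi X → E ∈ Γ.Phi X → E ≤ D →
      D - E ∈ Γ.Phi X)
    (hsupport : ∀ (X : FinSubextCat K Kt) (P : Γ.primeDiv X), ∃ f : Γ.B X, (Multiplicative.toAdd (Γ.div X f)) P ≠ 0)
    (hF : PreFrobenioid.IsFrobenioid
      (ModelFrobenioid.toElem (geomDivisorFunctor Γ) (geomUnitsFunctor Γ) (geomDivNatTrans Γ)))
    (hsq : PreFrobenioid.HasBiratSquares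
      (ModelFrobenioid.toElem (geomDivisorFunctor Γ) (geomUnitsFunctor Γ) (geomDivNatTrans Γ)))
    (Supp : ∀ {X : FinSubextCat K Kt}, (geomFrobenioidOps Γ).Mon X → Primes ((geomFrobenioidOps Γ).Mon X) → Prop)
    (hSupp : ∀ (X : FinSubextCat K Kt) (a : Multiplicative (Γ.Phi X)) (𝔭 : Primes (Multiplicative (Γ.Phi X))),
      Supp a 𝔭 ↔ ∃ (a₀ : Multiplicative (Γ.Phi X)) (h₀ : IsPrimary a₀),
        Quotient.mk (primarySetoid _) ⟨a₀, h₀⟩ = 𝔭 ∧ Precsim a₀ a)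
    (A : geomFrobenioid Γ) :
    PreFrobenioidData.IsStrictlyRational (PreFrobenioid.biratData hF hsq) Supp A := by
  refine (ModelFrobenioid.isStrictlyRational_biratData_iff (geomUnitsFunctor_isGroupLike Γ)
    (fun X => Γ.isDivisorial_phi_of_sub_mem X (hsub X)) hF hsq Supp A).mpr fun 𝔭 => ?_
  -- a primary representative of `𝔭`, supported at a single prime divisor `s`
  obtain ⟨⟨a₀, ha₀⟩, rfl⟩ := Quotient.exists_rep 𝔭
  let D₀ : Γ.Phi A.base := Multiplicative.toAdd (α := Γ.Phi A.base) a₀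
  have ha₀' : IsPrimary (Multiplicative.ofAdd D₀) := ha₀
  obtain ⟨s, hs⟩ := Γ.support_eq_singleton_of_isPrimary A.base ha₀'
  have hs0 : (D₀ : Γ.primeDiv A.base →₀ ℕ) s ≠ 0 :=
    Finsupp.mem_support_iff.mp (by rw [hs]; exact Finset.mem_singleton_self s)
  have hD₀ : (D₀ : Γ.primeDiv A.base →₀ ℕ) = Finsupp.single s ((D₀ : Γ.primeDiv A.base →₀ ℕ) s) :=
    Finsupp.support_subset_singleton.mp (by rw [hs])
  have hmem₀ : Finsupp.single s ((D₀ : Γ.primeDiv A.base →₀ ℕ) s) ∈ Γ.Phi A.base := hD₀ ▸ D₀.2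
  have ha₀eq : Multiplicative.ofAdd D₀ = Multiplicative.ofAdd ⟨_, hmem₀⟩ :=
    congrArg Multiplicative.ofAdd (Subtype.ext hD₀)
  -- zero/pole decomposition of a rational function with `s` in the support of its divisor
  obtain ⟨f, hf⟩ := hsupport A.base s
  obtain ⟨g, D, E, hD, hE, hdiv, hsD, hsE⟩ := Γ.exists_zero_pole_decomposition A.base s f hf
  refine ⟨Multiplicative.ofAdd ⟨D, hD⟩, Multiplicative.ofAdd ⟨E, hE⟩, ⟨g, ?_⟩, ?_, ?_⟩
  · exact Γ.of_div_of_eq_divPhi A.base hD hE g hdiv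
  · -- `𝔭 ∈ Supp(D)`: `a₀ = D₀_s · s ≼ D`
    refine (hSupp A.base _ _).mpr ⟨Multiplicative.ofAdd D₀, ha₀', rfl, ?_⟩
    rw [ha₀eq]
    exact Γ.single_precsim_of_mem_support A.base hmem₀ ⟨D, hD⟩ hsD
  · -- `𝔭 ∉ Supp(E)`: a primary `a₁ ~ a₀` with `a₁ ≼ E` would put `s` in `supp E`
    rintro hSE
    obtain ⟨a₁, ha₁, hrep, hprec⟩ := (hSupp A.base _ _).mp hSE
    have h10 : Precsim a₁ (Multiplicative.ofAdd D₀) := Quotient.exact hrep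
    have h01 : Precsim (Multiplicative.ofAdd D₀) a₁ := ha₀'.2 a₁ ha₁.1 h10
    have hsub' := Γ.support_subset_of_precsim A.base
      (show Precsim (Multiplicative.ofAdd D₀) (Multiplicative.ofAdd (⟨E, hE⟩ : Γ.Phi A.base)) from h01.trans hprec)
    rw [hs] at hsub'
    exact hsE (hsub' (Finset.mem_singleton_self s))

/-- Hence every object of `C_{K̃/K}` is RATIONAL (Def. 4.5 (ii)) under the same hypotheses.
[cite: MochizukiFrdI2008, Thm. 6.2 (iii) p.112] -/
theorem isRational_geom
    (hsub : ∀ (X : FinSubextCat K Kt) (D E : Γ.primeDiv X →₀ ℕ), D ∈ Γ.Phi X → E ∈ Γ.Phi X → E ≤ D →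
      D - E ∈ Γ.Phi X)
    (hsupport : ∀ (X : FinSubextCat K Kt) (P : Γ.primeDiv X), ∃ f : Γ.B X, (Multiplicative.toAdd (Γ.div X f)) P ≠ 0)
    (hF : PreFrobenioid.IsFrobenioid
      (ModelFrobenioid.toElem (geomDivisorFunctor Γ) (geomUnitsFunctor Γ) (geomDivNatTrans Γ)))
    (hsq : PreFrobenioid.HasBiratSquares
      (ModelFrobenioid.toElem (geomDivisorFunctor Γ) (geomUnitsFunctor Γ) (geomDivNatTrans Γ)))
    (Supp : ∀ {X : FinSubextCat K Kt}, (geomFrobenioidOps Γ).Mon X → Primes ((geomFrobenioidOps Γ).Mon X) → Prop)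
    (hSupp : ∀ (X : FinSubextCat K Kt) (a : Multiplicative (Γ.Phi X)) (𝔭 : Primes (Multiplicative (Γ.Phi X))),
      Supp a 𝔭 ↔ ∃ (a₀ : Multiplicative (Γ.Phi X)) (h₀ : IsPrimary a₀),
        Quotient.mk (primarySetoid _) ⟨a₀, h₀⟩ = 𝔭 ∧ Precsim a₀ a)
    (A : geomFrobenioid Γ) :
    PreFrobenioidData.IsRational (PreFrobenioid.biratData hF hsq) Supp A :=
  ⟨A, 𝟙 A, PreFrobenioidData.isPullbackMorphism_id _ A,
    isStrictlyRational_geom Γ hsub hsupport hF hsq Supp hSupp A⟩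

end Geom

end Literature.AlgebraicGeometry.Frobenioids

end
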